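import Literature.AlgebraicGeometry.Resolution.Blowups
import Literature.AlgebraicGeometry.Resolution.MarkedIdeals
import Literature.AlgebraicGeometry.Resolution.DiffIdealSheaf
import Literature.AlgebraicGeometry.Resolution.BlowupSequences
import Literature.AlgebraicGeometry.Resolution.HironakaTauScheme
import HarnessLib

/-!
# WeakOrderReduction — weak order-reduction sequences in dimension four graded by the pointwise class (phase 1 of
    «TauLadder»)

ROUTE-INDEPENDENT definitions module (no `Theses` import) for the decomp-res node TauLadder (lens-2 g6, CRITIC-LEDGER
row 40: CLEARED AS ATTACK NODE on `MaxContactCut.StepDimFour` 28011 ∧ 28009/28010/28543/28544 and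
`OrderCut.PencilResolveDimFour` 27135 BY NAME; source HOME/decomp-res-lens-2/g6/TauLadder.lean sha256 4e7e109c…,
critic's `lean check` rc 0).  It hosts the notions the route asides `MaxContactCut.RungFour/RungThree/RungTwo/RungOne`
are stated over:

* `WeakAdmissible`, `WeakResolution` — weakly permissible centre sequences and weak resolutions of a marked ideal
  (BGMW Def. 3.1.3 minus the snc clause).  These are the SAME recursions as the notions landed in
  `Theorems/MaxContactCutExhaustion.lean` (N27, commit f856c3e9a750); they are re-homed here because that module
  imports the route file `Theses.MaxContactCut`, which must itself import the present definitions (import cycle /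
  `lint.theses-cone`).  The kernels file `Theorems/MaxContactCutTauLadder.lean` proves the two versions agree
  (`weakAdmissible_iff`, `weakResolution_iff`) — dedup BY KERNEL, no second notion is intended.
* `IsContactPt g I n y` (MaxContactCut's pointwise CONTACT predicate verbatim), `tauAt hY I n y` (Hironaka's τ via the
  tree's `stalkTau`), `ClassGE g hY I n j y` (class ≥ j: `j ≤ 1` ∨ contact ∨ (`j ≤ 4` ∧ `j ≤ τ`)).
* `SeqDimFour j n` (glob-free global weak order reduction in dimension four at order `n` for data of class ≥ j),
  the family `E j := ∀ n ≥ 1, SeqDimFour j n`, B–V's native form `SeqDimFourTau j n`, the perfect-field slice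
  `SeqDimFourPerfect j n`; pure-logic kernels `classGE_mono`, `seqDimFour_mono`, `e_mono`, `rung_of_e_one`,
  `seqDimFourTau_of_seqDimFour`, `seqDimFourPerfect_of_seqDimFour`.

[BierstoneGrigorievMilmanWlodarczyk2011 Def. 3.1.3; BenitoVillamayor2012 = arXiv:1103.3464 Thm 2.11;
    CossartPiltant2008
(Hironaka τ); Giraud1975]
-/

open CategoryTheory AlgebraicGeometry
open Literature.AlgebraicGeometry.Resolution

namespace Summit.ResolutionOfSingularities.ResolutionOfSingularities.Theorems.WeakOrderReduction

/-! ## Weakly permissible sequences (the tree's BGMW notions minus the snc clause) — same recursion as in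
`Theorems.MaxContactCutExhaustion` (route-independent home; agreement proved in `Theorems.MaxContactCutTauLadder`) -/

/-- `s` is WEAKLY ADMISSIBLE for the marked ideal `M = (X, 𝓘, E, μ)`: every centre is a regular scheme and
lies in the support `supp(𝓘_i, μ)` of the current controlled transform (BGMW Def. 3.1.3 (1) without the snc
clause (2)).  DEFINITION (support); equals `MaxContactCutExhaustion.WeakAdmissible` (kernel `weakAdmissible_iff`).
[cite: BierstoneGrigorievMilmanWlodarczyk2011, Def. 3.1.3] -/
def WeakAdmissible : {X : Scheme.{0}} → CentreSeq X → MarkedIdeal X → Prop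
  | _, .nil _, _ => True
  | _, .cons C rest, M => (C.support : Set _) ⊆ M.support ∧ Scheme.IsRegular C.subscheme ∧
      WeakAdmissible rest (M.transform (blowup.π C) C)

/-- `s` is a WEAK RESOLUTION of `M`: weakly admissible with empty final support `supp(𝓘_r, μ) = ∅`.
DEFINITION (support); equals `MaxContactCutExhaustion.WeakResolution` (kernel `weakResolution_iff`).
[cite: BierstoneGrigorievMilmanWlodarczyk2011, Def. 3.1.3] -/
def WeakResolution {X : Scheme.{0}} (s : CentreSeq X) (M : MarkedIdeal X) : Prop :=
  WeakAdmissible s M ∧ (s.transformMarked M).support = ∅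

/-! ## Pointwise classes at a point `y` of top order `n` -/

/-- CONTACT(I,n,y) — MaxContactCut's pointwise predicate VERBATIM (Villamayor e₀ = 0: some `u ∈ Diff^{≤
    n-1}_{Y/k}(I)` has
germ in `𝔪_y ∖ 𝔪_y²`).  DEFINITION (support). -/
def IsContactPt {k : Type} [Field k] {Y : Scheme.{0}} (g : Y ⟶ Spec (.of k)) (I : Y.IdealSheafData) (n : ℕ)
    (y : Y) : Prop :=
  ∃ U : Y.affineOpens, ∃ hy : y ∈ (U : Y.Opens),
    ∃ u ∈ (diffIdealSheaf (g.appTop.hom.comp (Scheme.ΓSpecIso (.of k)).inv.hom) (n - 1) I).ideal U,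
      (Y.presheaf.germ U y hy).hom u ∈ IsLocalRing.maximalIdeal (Y.presheaf.stalk y) ∧
      (Y.presheaf.germ U y hy).hom u ∉ IsLocalRing.maximalIdeal (Y.presheaf.stalk y) ^ 2

/-- Hironaka's `τ(y)` of the pair `(I, n)` at the point `y` of the REGULAR scheme `Y` — the tree's `stalkTau`
    (CossartPiltant2008,
`Literature…HironakaTauScheme`), the regular-local-ring instance supplied from `hY`.  At a top point it is B–V's
    codimensional
type of `Diff(𝒪[IWⁿ])` (module docstring).  DEFINITION (support). -/
noncomputable def tauAt {Y : Scheme.{0}} (hY : Scheme.IsRegular Y) (I : Y.IdealSheafData) (n : ℕ) (y : Y) : ℕ :=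
  haveI : IsRegularLocalRing (Y.presheaf.stalk y) := hY y
  stalkTau I y n

/-- CLASS ≥ j at `y`: `j ≤ 1` (no condition) ∨ CONTACT ∨ (`j ≤ 4` ∧ `j ≤ τ(y)`).  So class ≥ 5 ⟺ contact, and for
j = 2, 3, 4 class ≥ j ⟺ contact or contact-free-with-τ ≥ j.  DEFINITION (support). -/
def ClassGE {k : Type} [Field k] {Y : Scheme.{0}} (g : Y ⟶ Spec (.of k)) (hY : Scheme.IsRegular Y)
    (I : Y.IdealSheafData) (n j : ℕ) (y : Y) : Prop :=
  j ≤ 1 ∨ IsContactPt g I n y ∨ (j ≤ 4 ∧ j ≤ tauAt hY I n y)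

/-! ## The graded statements -/

/-- **`SeqDimFour j n`** — Glob-free global WEAK ORDER REDUCTION in dimension four at order `n` for data of class ≥ j:
for every prime p, field k of char p, regular separated finite-type quasi-compact `Y/k` with `dim Y ≤ 4`, and ideal
    sheaf `I`
with `ord_y I ≤ n` everywhere such that EVERY point of order exactly `n` has class ≥ j, there is `t : CentreSeq Y`
    which is a
weak resolution of `(I, ∅, n)`.  j = 5: lens-5's `ContactOrderSequenceDimFourAt n` (kernel `seqDimFour_five_iff`);
j = 1: all data.  STATEMENT SCHEMA (support). -/
def SeqDimFour (j n : ℕ) : Prop :=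
  ∀ p : ℕ, p.Prime → ∀ (k : Type) [Field k] [CharP k p]
    (Y : Scheme.{0}) (g : Y ⟶ Spec (.of k)), IsSeparated g → LocallyOfFiniteType g → QuasiCompact g →
    ∀ hY : Scheme.IsRegular Y, topologicalKrullDim Y ≤ 4 →
    ∀ I : Y.IdealSheafData, (∀ y : Y, idealOrder I y ≤ ((n : ℕ) : ℕ∞)) →
      (∀ y : Y, idealOrder I y = ((n : ℕ) : ℕ∞) → ClassGE g hY I n j y) →
      ∃ t : CentreSeq Y, WeakResolution t (⟨I, [], n⟩ : MarkedIdeal Y)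

/-- The FAMILY over all orders `n ≥ 1` (B–V's induction on the codimensional type consumes all markings). -/
def E (j : ℕ) : Prop := ∀ n : ℕ, 1 ≤ n → SeqDimFour j n

/-- aside · B–V's NATIVE statement «all top points have τ ≥ j» (no contact disjunct) in dimension four at order n —
    the form in
which the engines are printed; implied by `SeqDimFour j n` for `j ≤ 4` (kernel `seqDimFourTau_of_seqDimFour`). -/
def SeqDimFourTau (j n : ℕ) : Prop :=
  ∀ p : ℕ, p.Prime → ∀ (k : Type) [Field k] [CharP k p]
    (Y : Scheme.{0}) (g : Y ⟶ Spec (.of k)), IsSeparated g → LocallyOfFiniteType g → QuasiCompact g →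
    ∀ hY : Scheme.IsRegular Y, topologicalKrullDim Y ≤ 4 →
    ∀ I : Y.IdealSheafData, (∀ y : Y, idealOrder I y ≤ ((n : ℕ) : ℕ∞)) →
      (∀ y : Y, idealOrder I y = ((n : ℕ) : ℕ∞) → j ≤ tauAt hY I n y) →
      ∃ t : CentreSeq Y, WeakResolution t (⟨I, [], n⟩ : MarkedIdeal Y)

/-- aside · the PERFECT-FIELD slice of `SeqDimFour j n` (the slice on which the B–V / Hironaka engines are printed).
    -/
def SeqDimFourPerfect (j n : ℕ) : Prop :=
  ∀ p : ℕ, p.Prime → ∀ (k : Type) [Field k] [CharP k p] [PerfectField k]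
    (Y : Scheme.{0}) (g : Y ⟶ Spec (.of k)), IsSeparated g → LocallyOfFiniteType g → QuasiCompact g →
    ∀ hY : Scheme.IsRegular Y, topologicalKrullDim Y ≤ 4 →
    ∀ I : Y.IdealSheafData, (∀ y : Y, idealOrder I y ≤ ((n : ℕ) : ℕ∞)) →
      (∀ y : Y, idealOrder I y = ((n : ℕ) : ℕ∞) → ClassGE g hY I n j y) →
      ∃ t : CentreSeq Y, WeakResolution t (⟨I, [], n⟩ : MarkedIdeal Y)

/-! ## Kernels — pure logic -/

/-- Class ≥ j′ implies class ≥ j for j ≤ j′ (the ladder is cumulative in the HYPOTHESES). -/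
theorem classGE_mono {k : Type} [Field k] {Y : Scheme.{0}} {g : Y ⟶ Spec (.of k)} {hY : Scheme.IsRegular Y}
    {I : Y.IdealSheafData} {n j j' : ℕ} (hjj : j ≤ j') {y : Y} (h : ClassGE g hY I n j' y) :
    ClassGE g hY I n j y := by
  rcases h with h | h | ⟨h1, h2⟩
  · exact Or.inl (le_trans hjj h)
  · exact Or.inr (Or.inl h)
  · exact Or.inr (Or.inr ⟨le_trans hjj h1, le_trans hjj h2⟩)

/-- `SeqDimFour` is antitone in the class bound: fewer data to treat for larger j. -/
theorem seqDimFour_mono {j j' n : ℕ} (hjj : j ≤ j') (h : SeqDimFour j n) : SeqDimFour j' n := by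
  intro p hp k _ _ Y g hg1 hg2 hg3 hY hY4 I hord hcls
  exact h p hp k Y g hg1 hg2 hg3 hY hY4 I hord fun y hy => classGE_mono hjj (hcls y hy)

/-- The families are antitone likewise: `E 1 ⟹ E j ⟹ E j′` for `j ≤ j′`. -/
theorem e_mono {j j' : ℕ} (hjj : j ≤ j') (h : E j) : E j' :=
  fun n hn => seqDimFour_mono hjj (h n hn)

/-- Every rung is implied by the full statement `E 1` (each piece is weaker than the target BY LETTER). -/
theorem rung_of_e_one {j : ℕ} (hj : 1 ≤ j) (h : E 1) : E (j + 1) → E j :=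
  fun _ => e_mono hj h

/-- B–V's native τ ≥ j statement follows from the class-≥-j statement for j ≤ 4 (τ ≥ j points have class ≥ j). -/
theorem seqDimFourTau_of_seqDimFour {j n : ℕ} (hj : j ≤ 4) (h : SeqDimFour j n) : SeqDimFourTau j n := by
  intro p hp k _ _ Y g hg1 hg2 hg3 hY hY4 I hord hτ
  exact h p hp k Y g hg1 hg2 hg3 hY hY4 I hord fun y hy => Or.inr (Or.inr ⟨hj, hτ y hy⟩)

/-- The perfect-field slice is a specialisation. -/
theorem seqDimFourPerfect_of_seqDimFour {j n : ℕ} (h : SeqDimFour j n) : SeqDimFourPerfect j n := by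
  intro p hp k _ _ _ Y g hg1 hg2 hg3 hY hY4 I hord hcls
  exact h p hp k Y g hg1 hg2 hg3 hY hY4 I hord hcls

end Summit.ResolutionOfSingularities.ResolutionOfSingularities.Theorems.WeakOrderReduction
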